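import Literature.NumberTheory.Automorphic.UnitaryTwoTreeActionDescent          -- ★ B-p08 (g28) (W1c)-B generic: `rhoVertexAct`, `_one`, `_mul`, adjacency, hV, hD
import Literature.NumberTheory.Automorphic.UnitaryTwoAntidiagProjectiveDescent   -- ★ F0P3a-p04 (g13) (W1): `exists_conj_diagonal_eq_smul_map_toPlace`
import Literature.NumberTheory.Rogawski1990.UnitaryTwoTypeTwoEdgeCount           -- ★ B-p08: `placeForm_antidiagTwo_eq_antidiag` (+ the place API)
import Literature.NumberTheory.Automorphic.ValuedFieldValuativeRelBridge         -- ★ `isUniformizingElement_of_v_eq`, `isDiscreteValuationRing_integer_of_compatible`, `v_eq_iff_valuation_eq`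
import Literature.NumberTheory.Automorphic.Liu2021.LemD1AsPrintedIndexedNonVacuityRamifiedPlace  -- ★ `ramificationIdx'_eq_two_of_ne_one`
import Literature.NumberTheory.Automorphic.GaloisActionPlaces                    -- ★ `valued_galAdicCompletionMap`
import HarnessLib

/-!
# The action of `U(Φ₂)(L_w)` on the tree of `SL₂(L⁺_v)` at a NON-SPLIT place, and its transitivity on vertices and darts at a RAMIFIED place
# (Serre, *Trees* II.1.2–1.4; Tits 1979 §2.7, §3.9; Kottwitz 1988 §2)

Topic `NumberTheory/Automorphic`; namespace `Literature.NumberTheory.Automorphic.UnitaryGroup`.  ONE DEFINITION (`rhoVertexActPlace`, the place-level wrapper of ★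
`rhoVertexAct`) and theorems; no instance, no notation, no named fact, no `sorry`.  Cell `pub/hodgecm-mathlib` (D-0151), crux H413 = `stmt-HodgeConjecture-24833`, line
«N6nsGerm», residue «R2EP-wild» of `stub_N6nsR2EP : RankOneEulerPoincareNonsplit`, ROAD W brick (W1c)-B AT THE PLACE (owner B-p10 (g26) WORD W-1 (b): heads keyed on
`u : ↥U_w`, `U_w := unitaryGroupOfForm (galAdicCompletionMap (L := L) (IsCMField.complexConj L) hw) (placeForm Φ₂ w.1)`; consumers: F0P3a-p04 (g14) (W2) assembly,
A-p06 (g28) (W6-N), B-p10 (W6) fold over B-p14 (g32)'s ★ `…_of_vertexAction_local`).  HONEST LABEL: HC_CM is proved only modulo the cell's 2 remaining named inputs (hLiu418,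
h413) until rung 0 closes; nothing printed is asserted here.

THE MATHEMATICS.  `F = L⁺_v`, `E = L_w`, `ι = toPlace v w`, `σ = σ_w`, `X = latticeTree (RingHom.id F) ϖ_F J` the tree of `SL₂(F)` (★ (W0)), `α ∈ E` with `σα = −α ≠ 0`
(★ p843768 supplies one per type).  §1 `U_w = U(σ, (0 1; 1 0))` as subgroups (★ `placeForm_antidiagTwo_eq_antidiag`) and the DESCENT PROPERTY at `w` (★ (W1)
`exists_conj_diagonal_eq_smul_map_toPlace`).  §2 **`rhoVertexActPlace`** `:= rhoVertexAct ι σ ϖ_F (descent) ∘ inclusion` and its API transported from ★ (W1c)-B: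
`rhoVertexActPlace_eq_rhoVertexAct` (`rfl` bridge to the generic heads, e.g. the (W2) stabilisers), `rhoVertexActPlace_eq_iff_exists_zpow` (ANY representative `(s, g)`
computes it: `ρ(u) · M = N ↔ N = ϖ_F^k · gM`), `rhoVertexActPlace_one`, `rhoVertexActPlace_mul`, `latticeTree_adj_rhoVertexActPlace_iff`.  §3 At a RAMIFIED `w`
(`e(w|v) ≠ 1`): `N(ϖ_E) = ϖ_E σ(ϖ_E)` descends to `c ∈ F` with `|c|_F = |ϖ_F|_F` and `σ(ϖ_E⁻¹) ϖ_E⁻¹ ι(c) = 1` (`exists_valuation_eq_and_norm_eq_one_of_ramified`), so ★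
`exists_rhoVertexAct_eq` ∕ `exists_rhoVertexAct_eq_of_adj` give **`exists_rhoVertexActPlace_eq`** (ONE VERTEX ORBIT, `hV`) and **`exists_rhoVertexActPlace_eq_of_adj`**
(ONE DART ORBIT, `hD`) for `(x₀, x₁) = (latt 1, latt diag(1, ϖ_F))` — and, by symmetry of adjacency, for `(x₀, x₁) = (latt diag(1, ϖ_F), latt 1)` as well.

## References
* [Serre1980Trees] J.-P. Serre, *Trees* (1980), Ch. II §1.2–§1.4.
* [Tits1979] J. Tits, *Reductive groups over local fields*, PSPM 33.1 (1979), §2.7, §3.9.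
* [Kottwitz1988] R. E. Kottwitz, *Tamagawa numbers*, Ann. of Math. 127 (1988), §2.
-/

set_option autoImplicit false

noncomputable section

open NumberField IsDedekindDomain
open scoped Matrix ValuativeRel MatrixGroups
open Matrix ValuativeRel

namespace Literature.NumberTheory.Automorphic.UnitaryGroup

open Literature.NumberTheory.Automorphic Literature.NumberTheory.Automorphic.HermitianLatticeTree

section Place

variable (L : Type) [Field L] [NumberField L] [IsCMField L] (v : HeightOneSpectrum (𝓞 ↥(maximalRealSubfield L)))
  (w : PlacesOver L v) (hw : IsCMField.complexConj L • w.1 = w.1)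

/-! ## §1 `U_w = U(σ_w, (0 1; 1 0))` and the descent property at `w` -/

omit [IsCMField L] in
/-- The unitary group of `(Φ₂)_w` IS the unitary group of `!![0, 1; 1, 0]` (same subgroup of `GL₂(L_w)`). [cite: Serre1980Trees, Ch. II §1.2] -/
theorem unitaryGroupOfForm_placeForm_antidiagTwo_eq (σ : w.1.adicCompletion L →+* w.1.adicCompletion L) :
    unitaryGroupOfForm σ (placeForm (Matrix.of fun i j : Fin 2 => if i.val + j.val + 1 = 2 then (1 : L) else 0) w.1) =
      unitaryGroupOfForm σ !![(0 : w.1.adicCompletion L), 1; 1, 0] := by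
  rw [placeForm_antidiagTwo_eq_antidiag]

include hw in
/-- **THE DESCENT PROPERTY AT A NON-SPLIT PLACE** (★ (W1) `exists_conj_diagonal_eq_smul_map_toPlace`, in the hypothesis shape `hρ` of ★ `rhoVertexAct`).
[cite: Serre1980Trees, Ch. II §1.2–§1.3] [cite: Tits1979, §2.7 and §3.9] -/
theorem descent_of_mem_unitaryGroupOfForm_antidiag {α : w.1.adicCompletion L}
    (hα : galAdicCompletionMap (L := L) (IsCMField.complexConj L) hw α = -α) (hα0 : α ≠ 0) :
    ∀ u : GL (Fin 2) (w.1.adicCompletion L), u ∈ unitaryGroupOfForm (galAdicCompletionMap (L := L) (IsCMField.complexConj L) hw) !![(0 : w.1.adicCompletion L), 1; 1, 0] →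
      ∃ (s : w.1.adicCompletion L) (g : GL (Fin 2) (v.adicCompletion ↥(maximalRealSubfield L))), s ≠ 0 ∧
        Matrix.diagonal ![1, α] * (u : Matrix (Fin 2) (Fin 2) (w.1.adicCompletion L)) * Matrix.diagonal ![1, α⁻¹] =
          s • (g : Matrix (Fin 2) (Fin 2) (v.adicCompletion ↥(maximalRealSubfield L))).map (toPlace v w) :=
  fun _ hu => exists_conj_diagonal_eq_smul_map_toPlace (IsCMField.complexConj L) w (IsCMField.complexConj_ne_one L) hw hα hα0 hu

/-! ## §2 The action `ρ_w` of `U_w` on the tree of `SL₂(L⁺_v)` -/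

/-- **THE VERTEX ACTION OF `U_w = U(Φ₂)(L_w)` ON THE TREE OF `SL₂(L⁺_v)`** at a non-split place `w ∣ v`: `u ↦ ρ(u) · M` (★ `rhoVertexAct` over the descent property at
`w`, precomposed with the identification `U_w = U(σ_w, (0 1; 1 0))`).  Parameters: an anti-fixed `α ≠ 0` (`σ_w α = −α`) and a uniformiser `ϖ_F` of `L⁺_v`.
[cite: Serre1980Trees, Ch. II §1.2–§1.3] [cite: Tits1979, §2.7 and §3.9] -/
def rhoVertexActPlace {α : w.1.adicCompletion L} (hα : galAdicCompletionMap (L := L) (IsCMField.complexConj L) hw α = -α) (hα0 : α ≠ 0)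
    {ϖF : v.adicCompletion ↥(maximalRealSubfield L)} (hϖF : Valued.v ϖF = WithZero.exp (-1 : ℤ))
    (u : ↥(unitaryGroupOfForm (galAdicCompletionMap (L := L) (IsCMField.complexConj L) hw)
      (placeForm (Matrix.of fun i j : Fin 2 => if i.val + j.val + 1 = 2 then (1 : L) else 0) w.1)))
    (M : {M : Submodule 𝒪[v.adicCompletion ↥(maximalRealSubfield L)] (Fin 2 → v.adicCompletion ↥(maximalRealSubfield L)) //
      IsSpecialLattice (RingHom.id _) ϖF !![(0 : v.adicCompletion ↥(maximalRealSubfield L)), 1; -1, 0] M}) :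
    {M : Submodule 𝒪[v.adicCompletion ↥(maximalRealSubfield L)] (Fin 2 → v.adicCompletion ↥(maximalRealSubfield L)) //
      IsSpecialLattice (RingHom.id _) ϖF !![(0 : v.adicCompletion ↥(maximalRealSubfield L)), 1; -1, 0] M} :=
  haveI : IsDiscreteValuationRing 𝒪[v.adicCompletion ↥(maximalRealSubfield L)] := isDiscreteValuationRing_integer_of_compatible hϖF
  rhoVertexAct (toPlace v w) (galAdicCompletionMap (L := L) (IsCMField.complexConj L) hw) (isUniformizingElement_of_v_eq hϖF)
    (descent_of_mem_unitaryGroupOfForm_antidiag L v w hw hα hα0)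
    (Subgroup.inclusion (unitaryGroupOfForm_placeForm_antidiagTwo_eq L v w _).le u) M

section Action

variable {α : w.1.adicCompletion L} (hα : galAdicCompletionMap (L := L) (IsCMField.complexConj L) hw α = -α) (hα0 : α ≠ 0)
  {ϖF : v.adicCompletion ↥(maximalRealSubfield L)} (hϖF : Valued.v ϖF = WithZero.exp (-1 : ℤ))

/-- `rhoVertexActPlace` IS ★ `rhoVertexAct` at `(ι, σ) = (toPlace v w, σ_w)` on the included element (`rfl`; use it to apply the generic heads, e.g. the (W2)
stabilisers ★ `rhoVertexAct_root_eq_self_iff`). [cite: Serre1980Trees, Ch. II §1.2–§1.3] -/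
theorem rhoVertexActPlace_eq_rhoVertexAct [IsDiscreteValuationRing 𝒪[v.adicCompletion ↥(maximalRealSubfield L)]]
    (u : ↥(unitaryGroupOfForm (galAdicCompletionMap (L := L) (IsCMField.complexConj L) hw)
      (placeForm (Matrix.of fun i j : Fin 2 => if i.val + j.val + 1 = 2 then (1 : L) else 0) w.1)))
    (M : {M : Submodule 𝒪[v.adicCompletion ↥(maximalRealSubfield L)] (Fin 2 → v.adicCompletion ↥(maximalRealSubfield L)) //
      IsSpecialLattice (RingHom.id _) ϖF !![(0 : v.adicCompletion ↥(maximalRealSubfield L)), 1; -1, 0] M}) :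
    rhoVertexActPlace L v w hw hα hα0 hϖF u M =
      rhoVertexAct (toPlace v w) (galAdicCompletionMap (L := L) (IsCMField.complexConj L) hw) (isUniformizingElement_of_v_eq hϖF)
        (descent_of_mem_unitaryGroupOfForm_antidiag L v w hw hα hα0)
        (Subgroup.inclusion (unitaryGroupOfForm_placeForm_antidiagTwo_eq L v w _).le u) M := rfl

/-- `rhoVertexActPlace` on the image of `u′ ∈ U(σ_w, (0 1; 1 0))` under the identification of §1 is ★ `rhoVertexAct u′`. [cite: Serre1980Trees, Ch. II §1.2–§1.3] -/
theorem rhoVertexActPlace_inclusion [IsDiscreteValuationRing 𝒪[v.adicCompletion ↥(maximalRealSubfield L)]]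
    (u' : ↥(unitaryGroupOfForm (galAdicCompletionMap (L := L) (IsCMField.complexConj L) hw) !![(0 : w.1.adicCompletion L), 1; 1, 0]))
    (M : {M : Submodule 𝒪[v.adicCompletion ↥(maximalRealSubfield L)] (Fin 2 → v.adicCompletion ↥(maximalRealSubfield L)) //
      IsSpecialLattice (RingHom.id _) ϖF !![(0 : v.adicCompletion ↥(maximalRealSubfield L)), 1; -1, 0] M}) :
    rhoVertexActPlace L v w hw hα hα0 hϖF
        (Subgroup.inclusion (unitaryGroupOfForm_placeForm_antidiagTwo_eq L v w (galAdicCompletionMap (L := L) (IsCMField.complexConj L) hw)).ge u') M =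
      rhoVertexAct (toPlace v w) (galAdicCompletionMap (L := L) (IsCMField.complexConj L) hw) (isUniformizingElement_of_v_eq hϖF)
        (descent_of_mem_unitaryGroupOfForm_antidiag L v w hw hα hα0) u' M := by
  have hincl : Subgroup.inclusion (unitaryGroupOfForm_placeForm_antidiagTwo_eq L v w (galAdicCompletionMap (L := L) (IsCMField.complexConj L) hw)).le
      (Subgroup.inclusion (unitaryGroupOfForm_placeForm_antidiagTwo_eq L v w (galAdicCompletionMap (L := L) (IsCMField.complexConj L) hw)).ge u') = u' :=
    Subtype.ext (by rw [Subgroup.coe_inclusion, Subgroup.coe_inclusion])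
  rw [rhoVertexActPlace_eq_rhoVertexAct, hincl]

/-- **ANY REPRESENTATIVE COMPUTES `ρ_w`**: if `diag(1,α) u diag(1,α)⁻¹ = s · ι(g)` with `s ≠ 0`, then `ρ_w(u) · M = N ↔ N = ϖ_F^k · gM` for some `k ∈ ℤ`
(★ `rhoVertexAct_eq_glVertexAct` + ★ `glVertexAct_eq_iff`). [cite: Serre1980Trees, Ch. II §1.2–§1.3] -/
theorem rhoVertexActPlace_eq_iff_exists_zpow
    (u : ↥(unitaryGroupOfForm (galAdicCompletionMap (L := L) (IsCMField.complexConj L) hw)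
      (placeForm (Matrix.of fun i j : Fin 2 => if i.val + j.val + 1 = 2 then (1 : L) else 0) w.1)))
    {s : w.1.adicCompletion L} {g : GL (Fin 2) (v.adicCompletion ↥(maximalRealSubfield L))} (hs : s ≠ 0)
    (h : Matrix.diagonal ![1, α] * ((u : GL (Fin 2) (w.1.adicCompletion L)) : Matrix (Fin 2) (Fin 2) (w.1.adicCompletion L)) * Matrix.diagonal ![1, α⁻¹] =
      s • (g : Matrix (Fin 2) (Fin 2) (v.adicCompletion ↥(maximalRealSubfield L))).map (toPlace v w))
    (M N : {M : Submodule 𝒪[v.adicCompletion ↥(maximalRealSubfield L)] (Fin 2 → v.adicCompletion ↥(maximalRealSubfield L)) //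
      IsSpecialLattice (RingHom.id _) ϖF !![(0 : v.adicCompletion ↥(maximalRealSubfield L)), 1; -1, 0] M}) :
    rhoVertexActPlace L v w hw hα hα0 hϖF u M = N ↔ ∃ k : ℤ, N.1 = scaleLattice (ϖF ^ k) (mapGL g M.1) := by
  haveI : IsDiscreteValuationRing 𝒪[v.adicCompletion ↥(maximalRealSubfield L)] := isDiscreteValuationRing_integer_of_compatible hϖF
  rw [rhoVertexActPlace_eq_rhoVertexAct, rhoVertexAct_eq_glVertexAct (toPlace v w) (galAdicCompletionMap (L := L) (IsCMField.complexConj L) hw)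
    (isUniformizingElement_of_v_eq hϖF) (descent_of_mem_unitaryGroupOfForm_antidiag L v w hw hα hα0) _ hs (by rw [Subgroup.coe_inclusion]; exact h),
    glVertexAct_eq_iff]

/-- **`ρ_w(1) = id`**. [cite: Serre1980Trees, Ch. II §1.2–§1.3] -/
theorem rhoVertexActPlace_one
    (M : {M : Submodule 𝒪[v.adicCompletion ↥(maximalRealSubfield L)] (Fin 2 → v.adicCompletion ↥(maximalRealSubfield L)) //
      IsSpecialLattice (RingHom.id _) ϖF !![(0 : v.adicCompletion ↥(maximalRealSubfield L)), 1; -1, 0] M}) :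
    rhoVertexActPlace L v w hw hα hα0 hϖF 1 M = M := by
  haveI : IsDiscreteValuationRing 𝒪[v.adicCompletion ↥(maximalRealSubfield L)] := isDiscreteValuationRing_integer_of_compatible hϖF
  rw [rhoVertexActPlace_eq_rhoVertexAct, map_one, rhoVertexAct_one _ _ _ _ hα0]

/-- **`ρ_w(u u′) = ρ_w(u) ∘ ρ_w(u′)`**. [cite: Serre1980Trees, Ch. II §1.2–§1.3] -/
theorem rhoVertexActPlace_mul
    (u u' : ↥(unitaryGroupOfForm (galAdicCompletionMap (L := L) (IsCMField.complexConj L) hw)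
      (placeForm (Matrix.of fun i j : Fin 2 => if i.val + j.val + 1 = 2 then (1 : L) else 0) w.1)))
    (M : {M : Submodule 𝒪[v.adicCompletion ↥(maximalRealSubfield L)] (Fin 2 → v.adicCompletion ↥(maximalRealSubfield L)) //
      IsSpecialLattice (RingHom.id _) ϖF !![(0 : v.adicCompletion ↥(maximalRealSubfield L)), 1; -1, 0] M}) :
    rhoVertexActPlace L v w hw hα hα0 hϖF (u * u') M = rhoVertexActPlace L v w hw hα hα0 hϖF u (rhoVertexActPlace L v w hw hα hα0 hϖF u' M) := by
  haveI : IsDiscreteValuationRing 𝒪[v.adicCompletion ↥(maximalRealSubfield L)] := isDiscreteValuationRing_integer_of_compatible hϖF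
  rw [rhoVertexActPlace_eq_rhoVertexAct, map_mul, rhoVertexAct_mul _ _ _ _ hα0]
  rfl

/-- **`ρ_w(u)` PRESERVES AND REFLECTS ADJACENCY**. [cite: Serre1980Trees, Ch. II §1.2–§1.3] -/
theorem latticeTree_adj_rhoVertexActPlace_iff
    (u : ↥(unitaryGroupOfForm (galAdicCompletionMap (L := L) (IsCMField.complexConj L) hw)
      (placeForm (Matrix.of fun i j : Fin 2 => if i.val + j.val + 1 = 2 then (1 : L) else 0) w.1)))
    (a b : {M : Submodule 𝒪[v.adicCompletion ↥(maximalRealSubfield L)] (Fin 2 → v.adicCompletion ↥(maximalRealSubfield L)) //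
      IsSpecialLattice (RingHom.id _) ϖF !![(0 : v.adicCompletion ↥(maximalRealSubfield L)), 1; -1, 0] M}) :
    (latticeTree (RingHom.id _) ϖF !![(0 : v.adicCompletion ↥(maximalRealSubfield L)), 1; -1, 0]).Adj
        (rhoVertexActPlace L v w hw hα hα0 hϖF u a) (rhoVertexActPlace L v w hw hα hα0 hϖF u b) ↔
      (latticeTree (RingHom.id _) ϖF !![(0 : v.adicCompletion ↥(maximalRealSubfield L)), 1; -1, 0]).Adj a b := by
  haveI : IsDiscreteValuationRing 𝒪[v.adicCompletion ↥(maximalRealSubfield L)] := isDiscreteValuationRing_integer_of_compatible hϖF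
  rw [rhoVertexActPlace_eq_rhoVertexAct, rhoVertexActPlace_eq_rhoVertexAct]
  exact latticeTree_adj_rhoVertexAct_iff _ _ _ _ _ a b

/-! ## §3 At a RAMIFIED place: the norm `N(ϖ_E)` and ONE VERTEX ORBIT ∕ ONE DART ORBIT -/

omit [IsCMField L] in
/-- In `ℤᵐ⁰`-valued fields squaring is injective on values. [cite: Serre1980Trees, Ch. II §1.1] -/
theorem eq_of_sq_eq_sq {x y : WithZero (Multiplicative ℤ)} (h : x ^ 2 = y ^ 2) : x = y := by
  rcases lt_trichotomy x y with hlt | heq | hgt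
  · exact absurd h (ne_of_lt (pow_lt_pow_left₀ hlt zero_le two_ne_zero))
  · exact heq
  · exact absurd h (ne_of_gt (pow_lt_pow_left₀ hgt zero_le two_ne_zero))

include hw in
/-- **AT A RAMIFIED PLACE A UNIFORMISER OF `L⁺_v` IS A NORM UP TO A UNIT**: there are `c ∈ L⁺_v` with `|c| = |ϖ_F|` and `t ∈ L_w` with `σ(t) · t · ι(c) = 1`
(`ι(c) = ϖ_E σ(ϖ_E)` descends since it is `σ`-fixed; `t = ϖ_E⁻¹`; `|ι c|_w = |c|_v²` because `e(w|v) = 2`) — the hypothesis `hnorm` of ★ `exists_rhoVertexAct_eq`.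
[cite: Serre1980Trees, Ch. II §1.2–§1.4] [cite: Tits1979, §2.7 and §3.9] -/
theorem exists_valuation_eq_and_norm_eq_one_of_ramified (he : v.asIdeal.ramificationIdx' w.1.asIdeal ≠ 1)
    {ϖF : v.adicCompletion ↥(maximalRealSubfield L)} (hϖF : Valued.v ϖF = WithZero.exp (-1 : ℤ)) :
    ∃ (c : v.adicCompletion ↥(maximalRealSubfield L)) (t : w.1.adicCompletion L),
      valuation (v.adicCompletion ↥(maximalRealSubfield L)) c = valuation (v.adicCompletion ↥(maximalRealSubfield L)) ϖF ∧
        galAdicCompletionMap (L := L) (IsCMField.complexConj L) hw t * t * toPlace v w c = 1 := by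
  have hc1 : IsCMField.complexConj L ≠ 1 := IsCMField.complexConj_ne_one L
  -- a uniformiser of `L_w`
  obtain ⟨π, hπ⟩ := w.1.valuation_exists_uniformizer L
  have hϖE : Valued.v (π : w.1.adicCompletion L) = WithZero.exp (-1 : ℤ) := by rw [HeightOneSpectrum.valuedAdicCompletion_eq_valuation', hπ]
  have hϖE0 : (π : w.1.adicCompletion L) ≠ 0 := by
    intro h0; rw [h0, map_zero] at hϖE; exact WithZero.zero_ne_coe hϖE
  have hσϖE0 : galAdicCompletionMap (L := L) (IsCMField.complexConj L) hw (π : w.1.adicCompletion L) ≠ 0 := by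
    rw [map_ne_zero]; exact hϖE0
  -- `N(ϖ_E)` is `σ`-fixed, hence comes from `L⁺_v`
  have hfix : galAdicCompletionMap (L := L) (IsCMField.complexConj L) hw
      ((π : w.1.adicCompletion L) * galAdicCompletionMap (L := L) (IsCMField.complexConj L) hw (π : w.1.adicCompletion L)) =
      (π : w.1.adicCompletion L) * galAdicCompletionMap (L := L) (IsCMField.complexConj L) hw (π : w.1.adicCompletion L) := by
    rw [map_mul, galAdicCompletionMap_galAdicCompletionMap_of_smul_eq (IsCMField.complexConj L) w hc1 hw, mul_comm]
  obtain ⟨c, hc⟩ := exists_toPlace_eq_of_galAdicCompletionMap_eq (IsCMField.complexConj L) w hc1 hw _ hfix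
  refine ⟨c, (π : w.1.adicCompletion L)⁻¹, ?_, ?_⟩
  · -- valuations: `|c|_v² = |ι c|_w = |ϖ_E|² = |ϖ_F|_v²`
    have h2 : Valued.v (toPlace v w c) = Valued.v c ^ 2 := by
      rw [valued_toPlace, Liu2021.LemD1IndexedNonVacuityRamifiedPlace.ramificationIdx'_eq_two_of_ne_one L v (IsCMField.complexConj L) hc1 w hw he]
    have hsq : Valued.v c ^ 2 = Valued.v ϖF ^ 2 := by
      rw [← h2, hc, map_mul, valued_galAdicCompletionMap, hϖE, hϖF, pow_two]
    exact (v_eq_iff_valuation_eq c ϖF).1 (eq_of_sq_eq_sq hsq)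
  · rw [hc, map_inv₀]
    field_simp

variable (he : v.asIdeal.ramificationIdx' w.1.asIdeal ≠ 1)

include he in
/-- **ONE VERTEX ORBIT AT A RAMIFIED PLACE (`hV`)**: `U_w` moves the root `x₀` (`x₀ = latt 1 = 𝒪_v²`) to every vertex of the tree of `SL₂(L⁺_v)`.
[cite: Serre1980Trees, Ch. II §1.2–§1.4] [cite: Tits1979, §2.7 and §3.9] [cite: Kottwitz1988, §2] -/
theorem exists_rhoVertexActPlace_eq
    (x₀ : {M : Submodule 𝒪[v.adicCompletion ↥(maximalRealSubfield L)] (Fin 2 → v.adicCompletion ↥(maximalRealSubfield L)) //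
      IsSpecialLattice (RingHom.id _) ϖF !![(0 : v.adicCompletion ↥(maximalRealSubfield L)), 1; -1, 0] M})
    (hx₀ : x₀.1 = latt (1 : Matrix (Fin 2) (Fin 2) (v.adicCompletion ↥(maximalRealSubfield L))))
    (N : {M : Submodule 𝒪[v.adicCompletion ↥(maximalRealSubfield L)] (Fin 2 → v.adicCompletion ↥(maximalRealSubfield L)) //
      IsSpecialLattice (RingHom.id _) ϖF !![(0 : v.adicCompletion ↥(maximalRealSubfield L)), 1; -1, 0] M}) :
    ∃ u : ↥(unitaryGroupOfForm (galAdicCompletionMap (L := L) (IsCMField.complexConj L) hw)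
      (placeForm (Matrix.of fun i j : Fin 2 => if i.val + j.val + 1 = 2 then (1 : L) else 0) w.1)),
      rhoVertexActPlace L v w hw hα hα0 hϖF u x₀ = N := by
  haveI : IsDiscreteValuationRing 𝒪[v.adicCompletion ↥(maximalRealSubfield L)] := isDiscreteValuationRing_integer_of_compatible hϖF
  have hσι : ∀ x, galAdicCompletionMap (L := L) (IsCMField.complexConj L) hw (toPlace v w x) = toPlace v w x :=
    fun x => galAdicCompletionMap_toPlace (IsCMField.complexConj L) w w hw x
  obtain ⟨c, t, hc, ht⟩ := exists_valuation_eq_and_norm_eq_one_of_ramified L v w hw he hϖF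
  obtain ⟨u', hu'⟩ := exists_rhoVertexAct_eq (toPlace v w) (galAdicCompletionMap (L := L) (IsCMField.complexConj L) hw) (isUniformizingElement_of_v_eq hϖF)
    (descent_of_mem_unitaryGroupOfForm_antidiag L v w hw hα hα0) hσι hα hα0 ⟨c, t, hc, ht⟩ x₀ hx₀ N
  exact ⟨Subgroup.inclusion (unitaryGroupOfForm_placeForm_antidiagTwo_eq L v w _).ge u', by rw [rhoVertexActPlace_inclusion, hu']⟩

include he in
/-- **ONE DART ORBIT AT A RAMIFIED PLACE (`hD`)**: `U_w` moves the reference dart `(x₀, x₁) = (latt 1, latt diag(1, ϖ_F))` to every dart `(a, b)` of the tree of `SL₂(L⁺_v)`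
— edges AND inversions. [cite: Serre1980Trees, Ch. II §1.2–§1.4] [cite: Tits1979, §2.7 and §3.9] [cite: Kottwitz1988, §2] -/
theorem exists_rhoVertexActPlace_eq_of_adj
    (x₀ x₁ : {M : Submodule 𝒪[v.adicCompletion ↥(maximalRealSubfield L)] (Fin 2 → v.adicCompletion ↥(maximalRealSubfield L)) //
      IsSpecialLattice (RingHom.id _) ϖF !![(0 : v.adicCompletion ↥(maximalRealSubfield L)), 1; -1, 0] M})
    (hx₀ : x₀.1 = latt (1 : Matrix (Fin 2) (Fin 2) (v.adicCompletion ↥(maximalRealSubfield L))))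
    (hx₁ : x₁.1 = latt (Matrix.diagonal ![1, ϖF]))
    {a b : {M : Submodule 𝒪[v.adicCompletion ↥(maximalRealSubfield L)] (Fin 2 → v.adicCompletion ↥(maximalRealSubfield L)) //
      IsSpecialLattice (RingHom.id _) ϖF !![(0 : v.adicCompletion ↥(maximalRealSubfield L)), 1; -1, 0] M}}
    (hab : (latticeTree (RingHom.id _) ϖF !![(0 : v.adicCompletion ↥(maximalRealSubfield L)), 1; -1, 0]).Adj a b) :
    ∃ u : ↥(unitaryGroupOfForm (galAdicCompletionMap (L := L) (IsCMField.complexConj L) hw)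
      (placeForm (Matrix.of fun i j : Fin 2 => if i.val + j.val + 1 = 2 then (1 : L) else 0) w.1)),
      rhoVertexActPlace L v w hw hα hα0 hϖF u x₀ = a ∧ rhoVertexActPlace L v w hw hα hα0 hϖF u x₁ = b := by
  haveI : IsDiscreteValuationRing 𝒪[v.adicCompletion ↥(maximalRealSubfield L)] := isDiscreteValuationRing_integer_of_compatible hϖF
  have hσι : ∀ x, galAdicCompletionMap (L := L) (IsCMField.complexConj L) hw (toPlace v w x) = toPlace v w x :=
    fun x => galAdicCompletionMap_toPlace (IsCMField.complexConj L) w w hw x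
  obtain ⟨c, t, hc, ht⟩ := exists_valuation_eq_and_norm_eq_one_of_ramified L v w hw he hϖF
  obtain ⟨u', hu'a, hu'b⟩ := exists_rhoVertexAct_eq_of_adj (toPlace v w) (galAdicCompletionMap (L := L) (IsCMField.complexConj L) hw)
    (isUniformizingElement_of_v_eq hϖF) (descent_of_mem_unitaryGroupOfForm_antidiag L v w hw hα hα0) hσι hα hα0 ⟨c, t, hc, ht⟩ x₀ x₁ hx₀ hx₁ hab
  exact ⟨Subgroup.inclusion (unitaryGroupOfForm_placeForm_antidiagTwo_eq L v w _).ge u', by rw [rhoVertexActPlace_inclusion, hu'a],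
    by rw [rhoVertexActPlace_inclusion, hu'b]⟩

include he in
/-- The same with the roles of the two reference vertices exchanged: `(x₀, x₁) = (latt diag(1, ϖ_F), latt 1)` (for the `√π`-type keying `K♯_{diag(1,ϖ_E)}` = vertex,
`K` = edge of the (W2) assembly). [cite: Serre1980Trees, Ch. II §1.2–§1.4] [cite: Kottwitz1988, §2] -/
theorem exists_rhoVertexActPlace_eq_of_adj'
    (x₀ x₁ : {M : Submodule 𝒪[v.adicCompletion ↥(maximalRealSubfield L)] (Fin 2 → v.adicCompletion ↥(maximalRealSubfield L)) //
      IsSpecialLattice (RingHom.id _) ϖF !![(0 : v.adicCompletion ↥(maximalRealSubfield L)), 1; -1, 0] M})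
    (hx₀ : x₀.1 = latt (Matrix.diagonal ![1, ϖF]))
    (hx₁ : x₁.1 = latt (1 : Matrix (Fin 2) (Fin 2) (v.adicCompletion ↥(maximalRealSubfield L))))
    {a b : {M : Submodule 𝒪[v.adicCompletion ↥(maximalRealSubfield L)] (Fin 2 → v.adicCompletion ↥(maximalRealSubfield L)) //
      IsSpecialLattice (RingHom.id _) ϖF !![(0 : v.adicCompletion ↥(maximalRealSubfield L)), 1; -1, 0] M}}
    (hab : (latticeTree (RingHom.id _) ϖF !![(0 : v.adicCompletion ↥(maximalRealSubfield L)), 1; -1, 0]).Adj a b) :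
    ∃ u : ↥(unitaryGroupOfForm (galAdicCompletionMap (L := L) (IsCMField.complexConj L) hw)
      (placeForm (Matrix.of fun i j : Fin 2 => if i.val + j.val + 1 = 2 then (1 : L) else 0) w.1)),
      rhoVertexActPlace L v w hw hα hα0 hϖF u x₀ = a ∧ rhoVertexActPlace L v w hw hα hα0 hϖF u x₁ = b := by
  obtain ⟨u, hb, ha⟩ := exists_rhoVertexActPlace_eq_of_adj L v w hw hα hα0 hϖF he x₁ x₀ hx₁ hx₀ hab.symm
  exact ⟨u, ha, hb⟩

include he in
/-- `hV` from ANY base vertex `x₀` (e.g. `x₀ = latt diag(1, ϖ_F)`): `U_w` is transitive on the vertices of the tree at a ramified place.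
[cite: Serre1980Trees, Ch. II §1.2–§1.4] [cite: Kottwitz1988, §2] -/
theorem exists_rhoVertexActPlace_eq'
    (x₀ : {M : Submodule 𝒪[v.adicCompletion ↥(maximalRealSubfield L)] (Fin 2 → v.adicCompletion ↥(maximalRealSubfield L)) //
      IsSpecialLattice (RingHom.id _) ϖF !![(0 : v.adicCompletion ↥(maximalRealSubfield L)), 1; -1, 0] M})
    (N : {M : Submodule 𝒪[v.adicCompletion ↥(maximalRealSubfield L)] (Fin 2 → v.adicCompletion ↥(maximalRealSubfield L)) //
      IsSpecialLattice (RingHom.id _) ϖF !![(0 : v.adicCompletion ↥(maximalRealSubfield L)), 1; -1, 0] M}) :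
    ∃ u : ↥(unitaryGroupOfForm (galAdicCompletionMap (L := L) (IsCMField.complexConj L) hw)
      (placeForm (Matrix.of fun i j : Fin 2 => if i.val + j.val + 1 = 2 then (1 : L) else 0) w.1)),
      rhoVertexActPlace L v w hw hα hα0 hϖF u x₀ = N := by
  haveI : IsDiscreteValuationRing 𝒪[v.adicCompletion ↥(maximalRealSubfield L)] := isDiscreteValuationRing_integer_of_compatible hϖF
  have h0 : ϖF ≠ 0 := (isUniformizingElement_of_v_eq hϖF).ne_zero
  -- the root `latt 1` as a vertex, and `u₀` moving it to `x₀`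
  have hsd : IsSpecialLattice (RingHom.id _) ϖF !![(0 : v.adicCompletion ↥(maximalRealSubfield L)), 1; -1, 0]
      (latt (1 : Matrix (Fin 2) (Fin 2) (v.adicCompletion ↥(maximalRealSubfield L)))) :=
    Or.inl ((isSelfDualLattice_id_altJ_iff _).2 ⟨1, by rw [Units.val_one], by rw [Units.val_one, det_one, map_one]⟩)
  obtain ⟨u₀, hu₀⟩ := exists_rhoVertexActPlace_eq L v w hw hα hα0 hϖF he ⟨_, hsd⟩ rfl x₀
  obtain ⟨u₁, hu₁⟩ := exists_rhoVertexActPlace_eq L v w hw hα hα0 hϖF he ⟨_, hsd⟩ rfl N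
  refine ⟨u₁ * u₀⁻¹, ?_⟩
  have h := rhoVertexActPlace_mul L v w hw hα hα0 hϖF (u₁ * u₀⁻¹) u₀ ⟨_, hsd⟩
  rw [inv_mul_cancel_right, hu₁, hu₀] at h
  exact h.symm

end Action

end Place

end Literature.NumberTheory.Automorphic.UnitaryGroup

end

/-! ## ED. 2 (append-only): the named `glVertexAct` bridge for the (W2) assembly (F0P3a-p04 (g14) ★ p843857) and the (W6-N) `hstep` (A-p06 (g28)) -/

noncomputable section

open NumberField IsDedekindDomain
open scoped Matrix ValuativeRel MatrixGroups
open Matrix ValuativeRel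

namespace Literature.NumberTheory.Automorphic.UnitaryGroup

open Literature.NumberTheory.Automorphic Literature.NumberTheory.Automorphic.HermitianLatticeTree

section PlaceBridge

variable (L : Type) [Field L] [NumberField L] [IsCMField L] (v : HeightOneSpectrum (𝓞 ↥(maximalRealSubfield L)))
  (w : PlacesOver L v) (hw : IsCMField.complexConj L • w.1 = w.1)
  {α : w.1.adicCompletion L} (hα : galAdicCompletionMap (L := L) (IsCMField.complexConj L) hw α = -α) (hα0 : α ≠ 0)
  {ϖF : v.adicCompletion ↥(maximalRealSubfield L)} (hϖF : Valued.v ϖF = WithZero.exp (-1 : ℤ))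

/-- **THE NAMED BRIDGE `ρ_w(u) · M = g · M`**: for ANY descent representative `(s, g)` of `u` (`diag(1,α) u diag(1,α)⁻¹ = s · ι(g)`, `s ≠ 0`),
`rhoVertexActPlace u M = glVertexAct _ g M` (one `rw` onto F0P3a-p04 (g14)'s (W2) heads ★ `UnitaryTwoRamifiedTreeStabilizers`, which are keyed on `glVertexAct hϖ g`;
the proof `hϖ` of `IsUniformizingElement ϖF` is irrelevant). [cite: Serre1980Trees, Ch. II §1.2–§1.3] -/
theorem rhoVertexActPlace_eq_glVertexAct [IsDiscreteValuationRing 𝒪[v.adicCompletion ↥(maximalRealSubfield L)]]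
    (u : ↥(unitaryGroupOfForm (galAdicCompletionMap (L := L) (IsCMField.complexConj L) hw)
      (placeForm (Matrix.of fun i j : Fin 2 => if i.val + j.val + 1 = 2 then (1 : L) else 0) w.1)))
    {s : w.1.adicCompletion L} {g : GL (Fin 2) (v.adicCompletion ↥(maximalRealSubfield L))} (hs : s ≠ 0)
    (hsg : Matrix.diagonal ![1, α] * ((u : GL (Fin 2) (w.1.adicCompletion L)) : Matrix (Fin 2) (Fin 2) (w.1.adicCompletion L)) * Matrix.diagonal ![1, α⁻¹] =
      s • (g : Matrix (Fin 2) (Fin 2) (v.adicCompletion ↥(maximalRealSubfield L))).map (toPlace v w))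
    (M : {M : Submodule 𝒪[v.adicCompletion ↥(maximalRealSubfield L)] (Fin 2 → v.adicCompletion ↥(maximalRealSubfield L)) //
      IsSpecialLattice (RingHom.id _) ϖF !![(0 : v.adicCompletion ↥(maximalRealSubfield L)), 1; -1, 0] M}) :
    rhoVertexActPlace L v w hw hα hα0 hϖF u M = glVertexAct (isUniformizingElement_of_v_eq hϖF) g M := by
  rw [rhoVertexActPlace_eq_rhoVertexAct, rhoVertexAct_eq_glVertexAct (toPlace v w) (galAdicCompletionMap (L := L) (IsCMField.complexConj L) hw)
    (isUniformizingElement_of_v_eq hϖF) (descent_of_mem_unitaryGroupOfForm_antidiag L v w hw hα hα0) _ hs (by rw [Subgroup.coe_inclusion]; exact hsg)]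

end PlaceBridge

end Literature.NumberTheory.Automorphic.UnitaryGroup

end
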